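import Mathlib.Combinatorics.SetFamily.Intersecting
import Summits.CriticalPhenomena.PercolationContinuityZ3.Theorems.PercNearOneGluingNoHeavyLowerTailSahiCombTriWDiagonal
import Summits.CriticalPhenomena.PercolationContinuityZ3.Theorems.PercNearOneGluingNoHeavyLowerTailSahiCombTriWCoatoms
import Summits.CriticalPhenomena.PercolationContinuityZ3.Theorems.PercNearOneGluingNoHeavyLowerTailSahiCombTriWThreshold

/-!
# The antipodal correlation only sees the INTERSECTING CORE: `Cor_P(A,B) = Cor_P(A ∖ refl A, B ∖ refl B)`

Support file of the one-cut programme (crux `NoHeavyLowerTail`, stmt-CriticalPhenomena-4575; cell `prim-masterthm`, seat P5 gen 24; memo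
`FROM-prim-masterthm-p5-g24-SANDWICH.md` §7(c)(i), §7(n)).  For a family `A` its INTERSECTING CORE is `A ∖ refl A` (the members whose complement is NOT a member).  Pointwise
`[w ∈ A] − [wᶜ ∈ A] = [w ∈ A∖refl A] − [wᶜ ∈ A∖refl A]`, so the Gram form `Cor_P(A,B) = Σ_{w ∈ P} ([w∈A]−[wᶜ∈A])([w∈B]−[wᶜ∈B])` (`corP_eq_sum`) gives
**`corP_sdiff_refl : corP P (A ∖ refl A) (B ∖ refl B) = corP P A B`** for EVERY test family `P`.  For an up-set `A`, `A ∖ refl A` is again an up-set (`isUpperSet_sdiff_refl` of `…TriWDiagonal`), it is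
antipode-free and pairwise INTERSECTING (`Set.Intersecting`).  Consequently every criterion of the form "`Cor_P ≥ 0` on pairs of up-sets" — the constant
sandwich certificate `triW_nonneg_of_corP_nonneg`, and in particular the outer-layer Kleitman conjecture `ThresholdCorNonneg` (OLK) — needs checking on pairs of
INTERSECTING up-sets only: **`corP_nonneg_iff_intersecting`**, **`thresholdCorNonneg_iff_intersecting`**.  (This is the reduction behind the matching / co-covering forms of OLK in
the memo: for intersecting `U`, OLK(`A`,`U`) for all up-sets `A` ⟺ an injection `refl U ∩ T → U ∩ T`, `w ↦` a proper superset.)  No new definitions; all statements unconditional; std axioms. [this work]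
-/

namespace Summit.CriticalPhenomena.PercolationContinuityZ3.Theorems

namespace FiveUpSet

open Finset

variable {γ : Type} [DecidableEq γ] [Fintype γ]

/-! ### The intersecting core -/

/-- Membership in the intersecting core `A ∖ refl A`. [this work] -/
theorem mem_sdiff_refl {A : Finset (Finset γ)} {w : Finset γ} : w ∈ A \ refl A ↔ w ∈ A ∧ wᶜ ∉ A := by
  rw [mem_sdiff, mem_refl]

/-- The signed antipodal indicator does not change when a family is replaced by its core:
`[w ∈ A] − [wᶜ ∈ A] = [w ∈ A∖refl A] − [wᶜ ∈ A∖refl A]`. [this work] -/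
theorem sgnDiff_sdiff_refl (A : Finset (Finset γ)) (w : Finset γ) :
    sgnDiff (A \ refl A) (refl (A \ refl A)) w = sgnDiff A (refl A) w := by
  unfold sgnDiff
  simp only [mem_refl, mem_sdiff_refl, compl_compl]
  by_cases h1 : w ∈ A <;> by_cases h2 : wᶜ ∈ A <;> simp [h1, h2]

/-- **`Cor_P(A ∖ refl A, B ∖ refl B) = Cor_P(A, B)`** for every test family `P`. [this work] -/
theorem corP_sdiff_refl (P A B : Finset (Finset γ)) : corP P (A \ refl A) (B \ refl B) = corP P A B := by
  rw [corP_eq_sum, corP_eq_sum]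
  simp only [sgnDiff_sdiff_refl]

/-- The intersecting core is antipode-free: `(A ∖ refl A) ∩ refl (A ∖ refl A) = ∅`. [this work] -/
theorem sdiff_refl_inter_refl (A : Finset (Finset γ)) : (A \ refl A) ∩ refl (A \ refl A) = ∅ := by
  ext w
  simp only [mem_inter, mem_refl, mem_sdiff_refl, compl_compl, Finset.notMem_empty, iff_false, not_and, and_imp]
  intro _ h1 h2
  exact absurd h2 h1

/-- The intersecting core of an up-set is an INTERSECTING family (any two members meet). [this work] -/
theorem intersecting_sdiff_refl {A : Finset (Finset γ)} (hA : IsUpperSet (A : Set (Finset γ))) : ((A \ refl A : Finset (Finset γ)) : Set (Finset γ)).Intersecting := by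
  intro u hu v hv huv
  rw [mem_coe, mem_sdiff_refl] at hu hv
  have hsub : v ⊆ uᶜ := by
    intro x hx
    rw [mem_compl]
    exact fun hxu => (disjoint_left.1 huv) hxu hx
  exact hu.2 (hA hsub hv.1)

/-- An antipode-free up-set is intersecting. [this work] -/
theorem intersecting_of_inter_refl_eq_empty {A : Finset (Finset γ)} (hA : IsUpperSet (A : Set (Finset γ))) (h : A ∩ refl A = ∅) :
    (A : Set (Finset γ)).Intersecting := by
  have hc : A \ refl A = A := by
    ext w
    rw [mem_sdiff_refl]
    constructor
    · exact fun hw => hw.1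
    · intro hw
      refine ⟨hw, fun hw' => ?_⟩
      have : w ∈ A ∩ refl A := mem_inter.2 ⟨hw, mem_refl.2 hw'⟩
      rw [h] at this
      exact absurd this (Finset.notMem_empty w)
  rw [← hc]
  exact intersecting_sdiff_refl hA

/-- An intersecting family is antipode-free (for a nonempty ground set; over the empty type `∅ = univ` is its own complement). [this work] -/
theorem inter_refl_eq_empty_of_intersecting [Nonempty γ] {A : Finset (Finset γ)} (h : (A : Set (Finset γ)).Intersecting) : A ∩ refl A = ∅ := by
  ext w
  simp only [mem_inter, mem_refl, Finset.notMem_empty, iff_false, not_and]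
  intro hw hw'
  have := h (mem_coe.2 hw) (mem_coe.2 hw')
  exact this disjoint_compl_right

/-! ### The reductions -/

/-- **`Cor_P ≥ 0` on all pairs of up-sets ⟺ on all pairs of ANTIPODE-FREE (hence intersecting) up-sets.** [this work] -/
theorem corP_nonneg_iff_antipodeFree (P : Finset (Finset γ)) :
    (∀ A B : Finset (Finset γ), IsUpperSet (A : Set (Finset γ)) → IsUpperSet (B : Set (Finset γ)) → 0 ≤ corP P A B) ↔
    (∀ A B : Finset (Finset γ), IsUpperSet (A : Set (Finset γ)) → IsUpperSet (B : Set (Finset γ)) →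
      A ∩ refl A = ∅ → B ∩ refl B = ∅ → 0 ≤ corP P A B) := by
  constructor
  · exact fun h A B hA hB _ _ => h A B hA hB
  · intro h A B hA hB
    rw [← corP_sdiff_refl]
    exact h _ _ (isUpperSet_sdiff_refl hA hA) (isUpperSet_sdiff_refl hB hB) (sdiff_refl_inter_refl A) (sdiff_refl_inter_refl B)

/-- **`Cor_P ≥ 0` on all pairs of up-sets ⟺ on all pairs of INTERSECTING up-sets** (`Set.Intersecting`). [this work] -/
theorem corP_nonneg_iff_intersecting (P : Finset (Finset γ)) :
    (∀ A B : Finset (Finset γ), IsUpperSet (A : Set (Finset γ)) → IsUpperSet (B : Set (Finset γ)) → 0 ≤ corP P A B) ↔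
    (∀ A B : Finset (Finset γ), IsUpperSet (A : Set (Finset γ)) → IsUpperSet (B : Set (Finset γ)) →
      (A : Set (Finset γ)).Intersecting → (B : Set (Finset γ)).Intersecting → 0 ≤ corP P A B) := by
  constructor
  · exact fun h A B hA hB _ _ => h A B hA hB
  · intro h A B hA hB
    rw [← corP_sdiff_refl]
    exact h _ _ (isUpperSet_sdiff_refl hA hA) (isUpperSet_sdiff_refl hB hB) (intersecting_sdiff_refl hA) (intersecting_sdiff_refl hB)

/-- **OLK needs checking on INTERSECTING up-sets only**: the outer-layer Kleitman conjecture `ThresholdCorNonneg` is EQUIVALENT to its restriction to pairs of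
intersecting up-sets (an honest reformulation of the conjecture, not a proof of it). [this work] -/
theorem thresholdCorNonneg_iff_intersecting :
    ThresholdCorNonneg ↔
    (∀ (γ : Type) [DecidableEq γ] [Fintype γ] (k : ℕ), Fintype.card γ < 2 * k →
      ∀ A B : Finset (Finset γ), IsUpperSet (A : Set (Finset γ)) → IsUpperSet (B : Set (Finset γ)) →
        (A : Set (Finset γ)).Intersecting → (B : Set (Finset γ)).Intersecting → 0 ≤ corP (thresholdFamily γ k) A B) := by
  constructor
  · intro h γ _ _ k hk A B hA hB _ _
    exact h γ k hk A B hA hB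
  · intro h γ _ _ k hk
    exact (corP_nonneg_iff_intersecting (thresholdFamily γ k)).2 (h γ k hk)

/-- The Gram form restated for the record: `Cor_P(A,B) = Σ_{w∈P} s_A(w) s_B(w)` with `s_A(w) = [w∈A] − [wᶜ∈A] ∈ {−1,0,1}`; in particular `Cor_P` is SYMMETRIC. [this work] -/
theorem corP_comm (P A B : Finset (Finset γ)) : corP P A B = corP P B A := by
  rw [corP_eq_sum, corP_eq_sum]
  exact Finset.sum_congr rfl fun w _ => mul_comm _ _

/-! ### OLK when one family has no small members (appended, gen 24, memo §11(n)) -/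

/-- **`Cor_P(A,B) ≥ 0` whenever `B` has no member antipodal to `P`** (`B ∩ refl P = ∅`), for ANY up-set `P` and up-sets `A, B`: the two terms `#(P∩refl A∩refl B)` and
`#(P∩A∩refl B)` vanish, and `Cor_P(A,B) = #((P∩B)∩A) − #((P∩B)∩refl A) ≥ 0` is Kleitman's antipodal lemma (`card_inter_refl_le`) for the up-sets `P ∩ B` and `A`.
For a threshold family `P = {#w ≥ k}` the hypothesis says that every member of `B` has more than `n − k` elements (NO SMALL MEMBERS): the case `B⁻ = ∅` of the outer-layer
Kleitman conjecture `ThresholdCorNonneg`. [this work] -/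
theorem corP_nonneg_of_inter_refl_eq_empty {P A B : Finset (Finset γ)} (hP : IsUpperSet (P : Set (Finset γ)))
    (hA : IsUpperSet (A : Set (Finset γ))) (hB : IsUpperSet (B : Set (Finset γ))) (h : B ∩ refl P = ∅) : 0 ≤ corP P A B := by
  have h0 : ∀ w : Finset γ, w ∈ P → wᶜ ∈ B → False := by
    intro w hw hwB
    have hmem : wᶜ ∈ B ∩ refl P := mem_inter.2 ⟨hwB, mem_refl.2 (by rwa [compl_compl])⟩
    rw [h] at hmem
    exact absurd hmem (Finset.notMem_empty _)
  have h1 : P ∩ refl A ∩ refl B = ∅ := by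
    ext w
    simp only [mem_inter, mem_refl, Finset.notMem_empty, iff_false, not_and]
    exact fun hw hwB => h0 w hw.1 hwB
  have h2 : P ∩ A ∩ refl B = ∅ := by
    ext w
    simp only [mem_inter, mem_refl, Finset.notMem_empty, iff_false, not_and]
    exact fun hw hwB => h0 w hw.1 hwB
  have hPB : IsUpperSet ((P ∩ B : Finset (Finset γ)) : Set (Finset γ)) := by
    rw [coe_inter]
    exact hP.inter hB
  have hk := card_inter_refl_le hPB hA
  have e1 : P ∩ A ∩ B = P ∩ B ∩ A := by
    ext w
    simp only [mem_inter]
    tauto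
  have e2 : P ∩ refl A ∩ B = P ∩ B ∩ refl A := by
    ext w
    simp only [mem_inter]
    tauto
  unfold corP
  rw [h1, h2, e1, e2, card_empty]
  push_cast
  omega

/-- **OLK holds when one of the two families has no small members**: for `P = {#w ≥ k}` and up-sets `A, B` with `n − k < #b` for every `b ∈ B`, `0 ≤ Cor_P(A,B)`
(symmetrically in `A`, by `corP_comm`).  No parity / size hypothesis on `k` is needed. [this work] -/
theorem corP_threshold_nonneg_of_noSmall (k : ℕ) {A B : Finset (Finset γ)}
    (hA : IsUpperSet (A : Set (Finset γ))) (hB : IsUpperSet (B : Set (Finset γ)))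
    (hlarge : ∀ b ∈ B, Fintype.card γ - k < b.card) : 0 ≤ corP (thresholdFamily γ k) A B := by
  refine corP_nonneg_of_inter_refl_eq_empty (isUpperSet_thresholdFamily k) hA hB ?_
  ext b
  simp only [mem_inter, mem_refl, mem_thresholdFamily, Finset.notMem_empty, iff_false, not_and]
  intro hb hk
  have h1 := hlarge b hb
  have h2 : bᶜ.card = Fintype.card γ - b.card := Finset.card_compl b
  have h3 : b.card ≤ Fintype.card γ := card_le_univ b
  omega

/-- The same with the roles of `A` and `B` exchanged. [this work] -/
theorem corP_threshold_nonneg_of_noSmall_left (k : ℕ) {A B : Finset (Finset γ)}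
    (hA : IsUpperSet (A : Set (Finset γ))) (hB : IsUpperSet (B : Set (Finset γ)))
    (hlarge : ∀ a ∈ A, Fintype.card γ - k < a.card) : 0 ≤ corP (thresholdFamily γ k) A B := by
  rw [corP_comm]
  exact corP_threshold_nonneg_of_noSmall k hB hA hlarge

end FiveUpSet

end Summit.CriticalPhenomena.PercolationContinuityZ3.Theorems
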